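import Summits.QuantumFields.YangMills.Theorems.UnitScaleTiltProp7CovKernelMember
import Summits.QuantumFields.YangMills.Theorems.UnitScaleTiltProp7LinCorrRowOfHKsup
import Summits.QuantumFields.YangMills.Theorems.UnitScaleTiltProp7WindowMono
import HarnessLib

/-!
# Route `UnitScaleTilt`, crux K1 «MinimiserStabilityRegPr» (stmt-QuantumFields-19200), route-R E′ path (α′), (E1-b) — THE CLOSE AT THE MEMBER: the (E1)-door's socket row `hLrow` (pinned-slice
# exact corrector `L`, interpolant `I`, characterisation, pinning, solvability, and the contraction `row(L A) ≤ C·ℓ_k²‖D*_𝒰A‖_∞` with an L-ONLY constant `C`) at EVERY `RegPr` member of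
# record, UNCONDITIONALLY — both supplier rows discharged: (hK₂-cov) by px11 ✓p680458 and (hK-cov) `hKsup` by px22 g3's (A-cov) member theorem ✓`Prop7CovKernelMember.hKsup_member`

Cell `ym3-torus`, D-0154 (3c) twin-width seat `ym-routeR-w3` (gen 6) = namer of the (hK)∕(A)∕(E1-b) lineage; this file is the lineage's last composition:
px13 g4 ✓p684681 `Prop7LinCorrRowOfHKsup.hLrow_of_hKsup_member` (= ✓p681077∕✓p684415 `linCorr_gauge_le_of_hKsup_char` read at the knit's gauge, `κ ≤ c·ℓ_k`) ∘ px22 g3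
✓`Prop7CovKernelMember.hKsup_member` (the covariant (hK) row at `κ := cK·ℓ_k` over routeR-w6∕px11's two-generation transplant: ✓p681217 ✓p681742 ✓p685561 ✓p685688 ✓p684044 ✓p684704
✓p681947 ✓p680753) ∘ ✓p685317 `Prop7WindowMono.hwin_member_of_le` (the two suppliers' window constants merged: `c35 := max`, `a₅ := min`).  THEOREMS ONLY (0 `def`, 0 `sorry`);
`--supports stmt-QuantumFields-19200`, count-neutral.  YM₃ on T³ is a ladder rung (R3), not the Clay problem; nothing here claims the stub, the crux, d = 4 or the gap.  Members of
record only (`4 ≤ ℓ`, `a' + 3 ≤ m + n`, `8 ≤ (ℓ+1)^{a'}`, `2(ℓ+1)² ≤ R` — px4 g3's standing data); small members are not covered here.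

WHAT IS PROVED (ns `…Theorems.Prop7LinearCorrectorCloseMember`): ★★★ `linCorr_member (hℓ4 : 4 ≤ ℓ) : ∃ c35 a₅ c C₂ > 0, ∀ (member data) W, RegPr → window(c35) → ∀ w (admissible),
∃ I L, (I characterised) ∧ (L A = φ − Iφ) ∧ (pinned) ∧ (solvable) ∧ ∀ A, max ‖L A‖ (max (ℓ_k‖D_𝒰(L A)‖) (ℓ_k‖w·D*_𝒰D_𝒰(L A)‖)) ≤ max (3∕2·(c√2)) (max (c√2) C₂) · (ℓ_k²‖D*_𝒰A‖)`.
HONEST SCOPE.  Composition only; every analytic input is a landed theorem of the seats named above.  This is the (E1)-door ✓p683555's `hLrow` socket INHABITED at the members of record; the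
door's other socket (`hDatum`, Thm-2 data of the competitor) is not touched here.

References: T. Bałaban, CMP 102 (1985) 277–309 [Balaban1985Variational] (Prop. 7 p.299); CMP 99 (1985) 75–102 [Balaban1985RegularSpaces] ((1.36) p.82); CMP 99 (1985) 389–434
[Balaban1985BackgroundPropagators] ((3.8) p.392).
-/

set_option autoImplicit false

noncomputable section

open scoped BigOperators Matrix.Norms.L2Operator Matrix

namespace Summit.QuantumFields.YangMills.Theorems.Prop7LinearCorrectorCloseMember

open Literature.MathematicalPhysics.QuantumFieldTheory.Balaban1983to89
open Literature.MathematicalPhysics.QuantumFieldTheory.Balaban1983to89.T3ContinuumYM3Torus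
open Literature.MathematicalPhysics.QuantumFieldTheory.Balaban1983to89.T3PrintedRegularMinimiser (RegPr)
open Literature.MathematicalPhysics.QuantumFieldTheory.Balaban1983to89.B6GlobalChartV1 (PV)
open B9Eq39Adjoint (covD divB)
open B9TorusCalculus (torusT)
open B10Eq27TorusAxialLog (unitsField toUField)
open B15DeterminingSets (embIter)
open Summit.QuantumFields.YangMills.Theorems.Prop7SectET3Members (hd3)
open Summit.QuantumFields.YangMills.Theorems.Prop7LinCorrRowOfHKsup (hLrow_of_hKsup_member)
open Summit.QuantumFields.YangMills.Theorems.Prop7WindowMono (hwin_member_of_le)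
open Summit.QuantumFields.YangMills.Theorems.Prop7CovKernelMember (hKsup_member)

variable {ℓ : ℕ} {hL : Odd (ℓ + 1) ∧ 1 < ℓ + 1}

/-- ★★★ **(E1-b) CLOSED AT THE MEMBER.**  At every `RegPr` member of record (px4 g3's standing data `hℓ hm hk1 hsize hM8 hR2`, `0 < α₀ ≤ 1`, `(ℓ+1)(ℓ+1)^{a'}α₀ ≤ a₅`, and the window row at
`c35`), for every admissible weight `w` (`w ≤ tdist(·, 𝔅_k)`, `w ≤ ℓ_k`, `0 ≤ w`): the pinned `Δ_𝒰`-biharmonic interpolant `I` (characterised) and the exact pinned-slice corrector `L` exist,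
`L A = φ − Iφ` whenever `Δ_𝒰φ = D*_𝒰A`, `L A` vanishes on `𝔅_k`, every `A` is solvable, and
`max ‖L A‖ (max (ℓ_k‖D_𝒰(L A)‖) (ℓ_k‖w·D*_𝒰D_𝒰(L A)‖)) ≤ max (3∕2·(c√2)) (max (c√2) C₂) · (ℓ_k²·‖D*_𝒰A‖)` with `c35 a₅ c C₂` depending on `L = ℓ+1` only.
Proof: ✓`hLrow_of_hKsup_member` at `κ := c·ℓ_k` fed by ✓`hKsup_member`, the two windows merged by ✓`hwin_member_of_le` (`c35 := max c35₁ c35₂`, `a₅ := min a₅₁ a₅₂`).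
[cite: Balaban1985Variational, Prop. 7 p.299; Balaban1985RegularSpaces, (1.36) p.82; Balaban1985BackgroundPropagators, (3.8) p.392] -/
theorem linCorr_member (hℓ4 : 4 ≤ ℓ) :
    ∃ c35 a₅ c C₂ : ℝ, 0 < c35 ∧ 0 < a₅ ∧ 0 < c ∧ 0 < C₂ ∧
    ∀ (hℓ : 4 ≤ ℓ) (m : ℕ) (hm : 1 ≤ m) (n K a' R : ℕ) (hk1 : 1 ≤ K - n) (hsize : a' + 3 ≤ m + n) (hM8 : 8 ≤ (ℓ + 1) ^ a')
      (hR2 : 2 * (ℓ + 1) ^ 2 ≤ R) (α₀ : ℝ), 0 < α₀ → α₀ ≤ 1 → ((ℓ + 1 : ℕ) : ℝ) * (((ℓ + 1) ^ a' : ℕ) : ℝ) * α₀ ≤ a₅ →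
      ∀ W : GaugeField (PV 2 ℓ m K hd3 hL) 0 (Matrix.specialUnitaryGroup (Fin 2) ℂ),
        RegPr (⟨ℓ + 1, hL, m, hm⟩ : T3Family) n K α₀ W →
        (4 * 2197 * (24 * 289 * 24576 * 46116) : ℝ) * ((2 : ℕ) : ℝ) ^ 2 * ((((PV 2 ℓ m K hd3 hL).L : ℝ)) ^ (K - n)) ^ 4
            * ((((PV 2 ℓ m K hd3 hL).d : ℝ)) ^ 2 * (4 * ((2 : ℕ) : ℝ) * (α₀ * ((((PV 2 ℓ m K hd3 hL).L : ℝ))⁻¹) ^ (2 * (K - n))) ^ 2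
              + (2 * ((((ℓ + 1 : ℕ) : ℝ) ^ (K - n))⁻¹ * ((((ℓ + 1 : ℕ) : ℝ) ^ (K - n))⁻¹ * (c35 * (((ℓ + 1 : ℕ) : ℝ) * (((ℓ + 1) ^ a' : ℕ) : ℝ)) * α₀))
                  * Real.exp ((((ℓ + 1 : ℕ) : ℝ) ^ (K - n))⁻¹ * (c35 * (((ℓ + 1 : ℕ) : ℝ) * (((ℓ + 1) ^ a' : ℕ) : ℝ)) * α₀)))
                + 4 * ((((ℓ + 1 : ℕ) : ℝ) ^ (K - n))⁻¹ * (c35 * (((ℓ + 1 : ℕ) : ℝ) * (((ℓ + 1) ^ a' : ℕ) : ℝ)) * α₀)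
                  * Real.exp ((((ℓ + 1 : ℕ) : ℝ) ^ (K - n))⁻¹ * (c35 * (((ℓ + 1 : ℕ) : ℝ) * (((ℓ + 1) ^ a' : ℕ) : ℝ)) * α₀))) ^ 2) ^ 2)) ≤ 1 / 4 →
        -- THE (E1)-DOOR's SOCKET `hLrow` AT THIS MEMBER (✓ `pinnedSliceRow_of_thm2Datum`'s binder body with `F := ⟨ℓ+1, hL, m, hm⟩`, L-only constant)
        ∀ (w : Site ((⟨ℓ + 1, hL, m, hm⟩ : T3Family).P K) 0 → ℝ), (∀ (x : Site ((⟨ℓ + 1, hL, m, hm⟩ : T3Family).P K) 0) (y : Site ((⟨ℓ + 1, hL, m, hm⟩ : T3Family).P K) (K - n)), w x ≤ (Site.tdist x (embIter (K - n) y) : ℝ)) →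
                  (∀ x, w x ≤ (((⟨ℓ + 1, hL, m, hm⟩ : T3Family).L : ℕ) : ℝ) ^ (K - n)) → (∀ x, 0 ≤ w x) →
                ∃ (I : (Site ((⟨ℓ + 1, hL, m, hm⟩ : T3Family).P K) 0 → Matrix (Fin 2) (Fin 2) ℂ) →+ (Site ((⟨ℓ + 1, hL, m, hm⟩ : T3Family).P K) 0 → Matrix (Fin 2) (Fin 2) ℂ))
                  (L : (Fin ((⟨ℓ + 1, hL, m, hm⟩ : T3Family).P K).d → Site ((⟨ℓ + 1, hL, m, hm⟩ : T3Family).P K) 0 → Matrix (Fin 2) (Fin 2) ℂ) →+ (Site ((⟨ℓ + 1, hL, m, hm⟩ : T3Family).P K) 0 → Matrix (Fin 2) (Fin 2) ℂ)),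
                  -- (I) the pinned `Δ_W`-biharmonic interpolant, characterised
                  (∀ φ, ((∀ y : Site ((⟨ℓ + 1, hL, m, hm⟩ : T3Family).P K) (K - n), I φ (embIter (K - n) y) = φ (embIter (K - n) y)) ∧
                      ∀ x : Site ((⟨ℓ + 1, hL, m, hm⟩ : T3Family).P K) 0, x ∉ Set.range (embIter (K - n)) →
                        divB (torusT ((⟨ℓ + 1, hL, m, hm⟩ : T3Family).P K) 0) (fun κ z => unitsField (toUField W) ⟨z, κ⟩)
                          (fun μ => covD (torusT ((⟨ℓ + 1, hL, m, hm⟩ : T3Family).P K) 0) (fun κ z => unitsField (toUField W) ⟨z, κ⟩) μ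
                            (fun y => divB (torusT ((⟨ℓ + 1, hL, m, hm⟩ : T3Family).P K) 0) (fun κ z => unitsField (toUField W) ⟨z, κ⟩)
                              (fun ν => covD (torusT ((⟨ℓ + 1, hL, m, hm⟩ : T3Family).P K) 0) (fun κ z => unitsField (toUField W) ⟨z, κ⟩) ν (I φ)) y)) x = 0) ∧
                    ∀ χ, (∀ y : Site ((⟨ℓ + 1, hL, m, hm⟩ : T3Family).P K) (K - n), χ (embIter (K - n) y) = φ (embIter (K - n) y)) →
                      (∀ x : Site ((⟨ℓ + 1, hL, m, hm⟩ : T3Family).P K) 0, x ∉ Set.range (embIter (K - n)) →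
                        divB (torusT ((⟨ℓ + 1, hL, m, hm⟩ : T3Family).P K) 0) (fun κ z => unitsField (toUField W) ⟨z, κ⟩)
                          (fun μ => covD (torusT ((⟨ℓ + 1, hL, m, hm⟩ : T3Family).P K) 0) (fun κ z => unitsField (toUField W) ⟨z, κ⟩) μ
                            (fun y => divB (torusT ((⟨ℓ + 1, hL, m, hm⟩ : T3Family).P K) 0) (fun κ z => unitsField (toUField W) ⟨z, κ⟩)
                              (fun ν => covD (torusT ((⟨ℓ + 1, hL, m, hm⟩ : T3Family).P K) 0) (fun κ z => unitsField (toUField W) ⟨z, κ⟩) ν χ) y)) x = 0) → χ = I φ) ∧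
                  -- (L) the corrector for every potential
                  (∀ A φ, (∀ x, divB (torusT ((⟨ℓ + 1, hL, m, hm⟩ : T3Family).P K) 0) (fun κ z => unitsField (toUField W) ⟨z, κ⟩)
                        (fun μ => covD (torusT ((⟨ℓ + 1, hL, m, hm⟩ : T3Family).P K) 0) (fun κ z => unitsField (toUField W) ⟨z, κ⟩) μ φ) x
                      = divB (torusT ((⟨ℓ + 1, hL, m, hm⟩ : T3Family).P K) 0) (fun κ z => unitsField (toUField W) ⟨z, κ⟩) A x) → L A = φ - I φ) ∧
                  -- pinning
                  (∀ (A) (y : Site ((⟨ℓ + 1, hL, m, hm⟩ : T3Family).P K) (K - n)), L A (embIter (K - n) y) = 0) ∧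
                  -- solvability
                  (∀ A, ∃ φ, (∀ x, divB (torusT ((⟨ℓ + 1, hL, m, hm⟩ : T3Family).P K) 0) (fun κ z => unitsField (toUField W) ⟨z, κ⟩)
                        (fun μ => covD (torusT ((⟨ℓ + 1, hL, m, hm⟩ : T3Family).P K) 0) (fun κ z => unitsField (toUField W) ⟨z, κ⟩) μ φ) x
                      = divB (torusT ((⟨ℓ + 1, hL, m, hm⟩ : T3Family).P K) 0) (fun κ z => unitsField (toUField W) ⟨z, κ⟩) A x) ∧ L A = φ - I φ) ∧
                  ∀ A, max ‖L A‖ (max ((((⟨ℓ + 1, hL, m, hm⟩ : T3Family).L : ℕ) : ℝ) ^ (K - n) * ‖(fun μ z => covD (torusT ((⟨ℓ + 1, hL, m, hm⟩ : T3Family).P K) 0) (fun κ z => unitsField (toUField W) ⟨z, κ⟩) μ (L A) z)‖)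
                      ((((⟨ℓ + 1, hL, m, hm⟩ : T3Family).L : ℕ) : ℝ) ^ (K - n) * ‖(fun x => ((w x : ℝ) : ℂ) • divB (torusT ((⟨ℓ + 1, hL, m, hm⟩ : T3Family).P K) 0) (fun κ z => unitsField (toUField W) ⟨z, κ⟩)
                        (fun μ => covD (torusT ((⟨ℓ + 1, hL, m, hm⟩ : T3Family).P K) 0) (fun κ z => unitsField (toUField W) ⟨z, κ⟩) μ (L A)) x)‖))
                    ≤ max (3 / 2 * (c * Real.sqrt 2)) (max (c * Real.sqrt 2) C₂) * (((((⟨ℓ + 1, hL, m, hm⟩ : T3Family).L : ℕ) : ℝ) ^ (K - n)) ^ 2 * ‖(fun x => divB (torusT ((⟨ℓ + 1, hL, m, hm⟩ : T3Family).P K) 0) (fun κ z => unitsField (toUField W) ⟨z, κ⟩) A x)‖) := by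
  obtain ⟨c₁, a₁, cK, hc₁, ha₁, hcK, H₁⟩ := hKsup_member (hL := hL) hℓ4
  obtain ⟨c₂, a₂, C₂, hc₂, ha₂, hC₂, H₂⟩ := hLrow_of_hKsup_member (hL := hL) hℓ4
  refine ⟨max c₁ c₂, min a₁ a₂, cK, C₂, lt_max_of_lt_left hc₁, lt_min ha₁ ha₂, hcK, hC₂, ?_⟩
  intro hℓ m hm n K a' R hk1 hsize hM8 hR2 α₀ hα₀ hα1 hMα W hreg hwin w hwC hwℓ hw0
  have hMα₁ := hMα.trans (min_le_left a₁ a₂)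
  have hMα₂ := hMα.trans (min_le_right a₁ a₂)
  have hwin₁ := hwin_member_of_le (hL := hL) m n K a' hα₀.le hc₁.le (le_max_left c₁ c₂) hwin
  have hwin₂ := hwin_member_of_le (hL := hL) m n K a' hα₀.le hc₂.le (le_max_right c₁ c₂) hwin
  have hKsup := H₁ hℓ m hm n K a' R hk1 hsize hM8 hR2 α₀ hα₀ hα1 hMα₁ W hreg hwin₁
  have hκ0 : 0 ≤ cK * (((ℓ + 1 : ℕ) : ℝ) ^ (K - n)) := by positivity
  exact H₂ hℓ m hm n K a' R hk1 hsize hM8 hR2 α₀ hα₀ hα1 hMα₂ W hreg hwin₂ _ cK hκ0 le_rfl hKsup w hwC hwℓ hw0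

end Summit.QuantumFields.YangMills.Theorems.Prop7LinearCorrectorCloseMember

end
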